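import Literature.Barriers.NavierStokesRegularity.SupNormGainObstruction
import Mathlib.Analysis.Analytic.Binomial
import Mathlib.Analysis.Analytic.Uniqueness
import HarnessLib

/-!
# Barrier: the time-Taylor series of the heat flow has FINITE radius already for Gaussian data
# (Kovalevskaya's heat-equation phenomenon) — no «Σ tⁿ uₙ converges for all t» scheme survives the
# linear part

Barrier catalogue entry for `NavierStokesRegularity` (D-0021), METHOD LEVEL, everything PROVED
(Mathlib's binomial series + the tree's explicit heat flow of Gaussians,
`Literature.Barriers.NavierStokesRegularity.heatExtension_exp_neg_mul_norm_sq`).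

A recurring scheme writes the solution of Navier–Stokes (or of its linear Stokes/heat part) as a
power series in time, `u(t,x) = Σₙ tⁿ uₙ(x)` with `uₙ₊₁ = (νΔuₙ − Σ…)/(n+1)`, and asserts convergence
for all `t ≥ 0` (or on a time interval independent of the datum) for all smooth rapidly decreasing
data. The LINEAR part alone refutes this: for the entire, Schwartz datum `g_a(x) = e^{−a|x|²}` on
`ℝⁿ` (`n ≥ 1`) the heat flow at the origin is

  `e^{tΔ} g_a (0) = (1 + 4at)^{−n/2}`      (`heatExtension_gaussian_origin`),

i.e. in the rescaled time `s = 4at` the profile `s ↦ (1+s)^{−n/2}`, whose Taylor series at `s = 0`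
is the binomial series with exponent `−n/2 ∉ ℕ`: radius of convergence EXACTLY `1`
(`timeProfile_hasFPowerSeriesOnBall`, `timeProfile_radius_eq_one`; Mathlib
`Real.one_add_rpow_hasFPowerSeriesOnBall_zero`, `binomialSeries_radius_eq_one`). By uniqueness of
power-series expansions EVERY expansion of the profile at `0` has radius `1`
(`radius_eq_one_of_hasFPowerSeriesAt`), so there is no expansion converging on a ball of radius
`> 1`, in particular no entire one (`not_hasFPowerSeriesOnBall_of_one_lt`): in the original time the
series `Σ tⁿ (∂ₜⁿ e^{tΔ}g_a)(0)/n!` diverges for `t > 1/(4a)` (`1/(4aν)` with viscosity), a bound that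
tends to `0` as the datum concentrates (`a → ∞`) — there is no datum-independent interval of
convergence, and for data analytic only in a strip (Kovalevskaya's `1/(1−x)`) the radius is `0`
(Cooke 1984, Ch. 2: «when t is anything other than 0 this series diverges … radius of convergence
is clearly zero»). The positive statement in the tree is time analyticity for `t > 0` with radius
proportional to `t` and to an `L^∞` bound (`Literature.Analysis.FluidPDE.DongZhang2020_timeDerivative_bounds_boundedMild`):
continuation in time by re-expansion therefore needs exactly the a priori `L^∞` control that is at
stake (cf. `SupNormGainObstruction`).

## References

* R. Cooke, *The Mathematics of Sonya Kovalevskaya*, Springer (1984), Ch. 2 (the heat-equation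
  counterexample to analytic solvability in time). [`Cooke1984`]
* D. Applebaum, *Semigroups of Linear Operators*, CUP (2019), §3.1.1 (Gaussian convolution
  semigroup). [`Applebaum2019`]
* H. Dong, Q. S. Zhang, J. Funct. Anal. 279 (2020) 108563, Thm. 2 (time analyticity for `t > 0`).
  [`DongZhang2020`]

WHAT THIS IS NOT: not a claim about NS regularity or blow-up; not a claim about any author beyond
the typed locator.
-/

noncomputable section

open MeasureTheory Filter Topology Set
open scoped ENNReal

namespace Literature.Barriers.NavierStokesRegularity

open Literature.Analysis.UnboundedOperators

/-! ## The time profile of the heat flow of a Gaussian at the origin -/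

section Heat

variable {E : Type*} [NormedAddCommGroup E] [InnerProductSpace ℝ E] [FiniteDimensional ℝ E]
  [MeasurableSpace E] [BorelSpace E]

/-- **Heat flow of a Gaussian at the origin, as a negative power**: for `0 < a`, `0 < t`,
`e^{tΔ}(e^{−a|·|²})(0) = (1 + 4at)^{−n/2}`, `n = dim E` (the Gaussian convolution semigroup,
Applebaum §3.1.1 eq. (3.1.3); tree `heatExtension_exp_neg_mul_norm_sq`).
[cite: Applebaum2019, §3.1.1 eq. (3.1.3) p. 48] -/
theorem heatExtension_gaussian_origin {a t : ℝ} (ha : 0 < a) (ht : 0 < t) :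
    heatExtension (fun y : E => Real.exp (-a * ‖y‖ ^ 2)) t 0 =
      (1 + 4 * a * t) ^ (-((Module.finrank ℝ E : ℝ) / 2)) := by
  rw [heatExtension_exp_neg_mul_norm_sq ha ht, norm_zero]
  have h : (0 : ℝ) ≤ 1 + 4 * a * t := by positivity
  simp only [ne_eq, OfNat.ofNat_ne_zero, not_false_eq_true, zero_pow, mul_zero, Real.exp_zero,
    mul_one, one_div]
  rw [Real.inv_rpow h, Real.rpow_neg h]

/-- The same value written in the rescaled time `s = 4at`: `e^{tΔ} g_a (0) = (1 + s)^{−n/2}` with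
`s = 4at`, i.e. the heat flow at the origin is the TIME PROFILE `s ↦ (1+s)^{−n/2}` evaluated at
`s = 4at`. [cite: Applebaum2019, §3.1.1 eq. (3.1.3) p. 48] -/
theorem heatExtension_gaussian_origin_eq_timeProfile {a t : ℝ} (ha : 0 < a) (ht : 0 < t) :
    heatExtension (fun y : E => Real.exp (-a * ‖y‖ ^ 2)) t 0 =
      (fun s : ℝ => (1 + s) ^ (-((Module.finrank ℝ E : ℝ) / 2))) (4 * a * t) := by
  rw [heatExtension_gaussian_origin ha ht]

end Heat

/-! ## The time profile `s ↦ (1+s)^{−n/2}`: binomial series, radius exactly `1` -/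

/-- **The time profile has the binomial series at `s = 0`, converging on the unit ball**:
`(1+s)^{−n/2} = Σₖ C(−n/2, k) sᵏ` for `|s| < 1` (Mathlib's `Real.one_add_rpow_hasFPowerSeriesOnBall_zero`).
In the original time this is the Taylor series of `t ↦ e^{tΔ}g_a(0)` at `t = 0`, converging for
`t < 1/(4a)`. Kovalevskaya's heat-equation phenomenon in its Gaussian variant (Cooke 1984, Ch. 2).
[cite: Cooke1984, Ch. 2 (Kovalevskaya's heat-equation counterexample)] -/
theorem timeProfile_hasFPowerSeriesOnBall (n : ℕ) :
    HasFPowerSeriesOnBall (fun s : ℝ => (1 + s) ^ (-((n : ℝ) / 2)))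
      (binomialSeries ℝ (-((n : ℝ) / 2))) 0 1 :=
  Real.one_add_rpow_hasFPowerSeriesOnBall_zero

/-- **The radius of that series is EXACTLY `1`** (the exponent `−n/2` is not a natural number for
`n ≥ 1`; Mathlib's `binomialSeries_radius_eq_one`): in the original time, radius `1/(4a)` — finite,
and `→ 0` as the Gaussian datum concentrates (`a → ∞`).
[cite: Cooke1984, Ch. 2 (Kovalevskaya's heat-equation counterexample)] -/
theorem timeProfile_radius_eq_one {n : ℕ} (hn : 0 < n) :
    (binomialSeries ℝ (-((n : ℝ) / 2))).radius = 1 := by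
  refine binomialSeries_radius_eq_one (𝕂 := ℝ) (𝔸 := ℝ) fun k => ?_
  have hneg : -((n : ℝ) / 2) < 0 := by
    have : (0 : ℝ) < n := by exact_mod_cast hn
    linarith
  have hk : (0 : ℝ) ≤ (k : ℝ) := Nat.cast_nonneg k
  exact ne_of_lt (hneg.trans_le hk)

/-- **Uniqueness: EVERY power-series expansion of the time profile at `0` has radius `1`.** So no
rearrangement or alternative recursion produces a time series with a larger disc of convergence.
[cite: Cooke1984, Ch. 2 (Kovalevskaya's heat-equation counterexample)] -/
theorem radius_eq_one_of_hasFPowerSeriesAt {n : ℕ} (hn : 0 < n)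
    {p : FormalMultilinearSeries ℝ ℝ ℝ}
    (hp : HasFPowerSeriesAt (fun s : ℝ => (1 + s) ^ (-((n : ℝ) / 2))) p 0) :
    p.radius = 1 := by
  rw [hp.eq_formalMultilinearSeries (timeProfile_hasFPowerSeriesOnBall n).hasFPowerSeriesAt]
  exact timeProfile_radius_eq_one hn

/-- **BARRIER: no time-Taylor expansion of the heat flow of a Gaussian converges beyond the unit
ball in `s = 4at` — in particular there is no expansion valid for all times.** For `n ≥ 1` and
every formal power series `p` and every `r > 1` (e.g. `r = ⊤`), `p` is NOT a power-series
expansion of `s ↦ (1+s)^{−n/2} = e^{(s/4a)Δ} g_a (0)` on the ball of radius `r`.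

BARRIER (structured block, D-0021):
technique_class: time-power-series taylor-series-in-time global-time-series-convergence analytic-continuation-in-time-without-apriori-bound series-expansion-schemes
blocks: schemes for NavierStokesRegularity (and «Euler as ν → 0» riders) whose decisive step is «the series `u = Σₙ tⁿ uₙ(x)` (or the Taylor series in `t` of the mild/Duhamel solution, or its term-by-term recursion `uₙ₊₁ = (νΔuₙ − B(u,u)ₙ)/(n+1)`) converges for all `t ≥ 0`, or on a time interval independent of the datum, for every smooth rapidly decreasing divergence-free datum»: the LINEAR part already fails — for the entire Schwartz datum `e^{−a|x|²}` (divergence-free versions: apply `curl` to `e^{−a|x|²} e₃`, whose heat flow at suitable points has the same time profile up to polynomial factors — not formalised here; the scalar statement suffices for schemes that treat components separately or claim convergence of the heat part) the expansion at `t = 0` has radius exactly `1/(4aν)` (this theorem with `timeProfile_radius_eq_one`, after `s = 4aνt`), which is finite and NOT uniform in the datum (`a → ∞`); for data analytic only in a strip the radius is `0` [cite: Cooke1984, Ch. 2 (Kovalevskaya's heat-equation counterexample)].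
because: `e^{tΔ}(e^{−a|·|²})(0) = (1+4at)^{−n/2}` (`heatExtension_gaussian_origin`) [cite: Applebaum2019, §3.1.1 eq. (3.1.3) p. 48]; `(1+s)^{−n/2}` has the binomial series at `0` with radius exactly `1` since `−n/2 ∉ ℕ` (Mathlib `Real.one_add_rpow_hasFPowerSeriesOnBall_zero`, `binomialSeries_radius_eq_one`); power-series expansions at a point are unique (`HasFPowerSeriesAt.eq_formalMultilinearSeries`), and `HasFPowerSeriesOnBall f p x r` forces `r ≤ p.radius`.
evasions_known: (a) time analyticity for `t > 0` with radius proportional to `t` (and to an `L^∞` bound of the solution) IS true — tree fact `Literature.Analysis.FluidPDE.DongZhang2020_timeDerivative_bounds_boundedMild` [cite: DongZhang2020, Thm. 2] — so re-expansion at `t₀ > 0` continues the solution by a factor `1 + c/N(‖u‖_∞)` per step: an honest time-series continuation is exactly as strong as the a priori `L^∞` control it presupposes (barrier `SupNormGainObstruction`: no uniform sup-norm gain is available from the linear part); (b) Gevrey/analytic regularity in SPACE with shrinking radius (Foias–Temam) is a different, true statement and does not give global time series; (c) short-time convergence of Picard/Taylor schemes for analytic data (Cauchy–Kovalevskaya-type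 in the Oseen–Leray setting) is classical and local only.
scope_caveats: (a) a statement about the LINEAR heat flow of one explicit scalar datum at one point — it refutes universal convergence claims («for all smooth data, all t») and datum-independent radii, nothing more; (b) phrased in the rescaled time `s = 4at` at unit diffusivity; viscosity `ν` enters as `s = 4aνt`; (c) dimension `n ≥ 1` arbitrary (`E` any nontrivial finite-dimensional real inner product space for the heat-flow identification; the series statements are about the scalar profile); (d) silent about nonlinear resummation methods (Borel/Padé) — those are not power series in `t` and need their own analysis; (e) the divergence-free (vector) version of the witness is described, not formalised.
status: established (proved here; Mathlib binomial series + tree heat-flow lemma)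
[cite: Cooke1984, Ch. 2 (Kovalevskaya's heat-equation counterexample)] -/
theorem not_hasFPowerSeriesOnBall_of_one_lt {n : ℕ} (hn : 0 < n)
    (p : FormalMultilinearSeries ℝ ℝ ℝ) {r : ℝ≥0∞} (hr : 1 < r) :
    ¬ HasFPowerSeriesOnBall (fun s : ℝ => (1 + s) ^ (-((n : ℝ) / 2))) p 0 r := by
  intro h
  have hle : r ≤ p.radius := h.r_le
  rw [radius_eq_one_of_hasFPowerSeriesAt hn h.hasFPowerSeriesAt] at hle
  exact absurd hle (not_le.2 hr)

/-- **Corollary: no ENTIRE time series.** There is no formal power series converging on all of `ℝ`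
to the time profile of the heat flow of a Gaussian (`n ≥ 1`): «`Σ tⁿ uₙ` converges for every
`t ≥ 0`» fails for the free heat flow of `e^{−a|x|²}` at the origin.
[cite: Cooke1984, Ch. 2 (Kovalevskaya's heat-equation counterexample)] -/
theorem not_exists_entire_timeSeries {n : ℕ} (hn : 0 < n) :
    ¬ ∃ p : FormalMultilinearSeries ℝ ℝ ℝ,
        HasFPowerSeriesOnBall (fun s : ℝ => (1 + s) ^ (-((n : ℝ) / 2))) p 0 ⊤ := by
  rintro ⟨p, hp⟩
  exact not_hasFPowerSeriesOnBall_of_one_lt hn p (by simp) hp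

end Literature.Barriers.NavierStokesRegularity
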